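import Summits.Ventures.HSemireg.WedgeWeilPurityTransport

/-!
# Venture HSemireg — the Weil-frame purity locus (3/3): weilPurity and weilPurity_vW

HONEST FRAMING. Part of the Lean index of the computation cell `pub-hsemireg` (second enclosure wave, cut by seat p6 in the
conventions of seat p3's ENCLOSURE-PLAN-p3.md / build.py from th-7's kernel assets).  Finite-dimensional exterior algebra over a field ONLY:
no variety, no cohomology theory, no semiregularity map is constructed here; nothing here says that HC / HC_CM / HC_AV holds;
no Literature fact is declared or used.  The geometric DICTIONARY (why these ranks are the `HT`-side box ranks of the cell's
STRUCTURE.md §1 / theory/FORMULA-N.md) lives in theory/FORMULA-N-th7.md PART B §A.3 / §N and is NOT asserted in Lean.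

th-7's PART W — THE WEIL-FRAME PURITY LOCUS: transport of PART V (`WedgeBoxPurityRank.lean`) to WeilRank's model (theory/th7/WeilPurity.lean v3.2 sha256/16 fa4f1543e639b652 (th-7 g5, 22:21Z 2026-08-22; ×2 farm rc 0 + axioms standard at p3 g9 21:58Z (v3.1 prefix), th-2 g22 22:27Z, p6 g7 22:32Z; statement reads + independent exact numerics p6 g6 X2-WEILPURITY-p6g6.md a0873432c5a1b400 (PART W 105/105, PART D 704/704) and p6 g7 X2-WEILPURITY-E-p6g7.md 6348f244af71037e (PART E 216/216)),
l.6385–6547 and the supplement l.6549–6715), VERBATIM up to namespaces (`HSemiregWeilPurity` ↦ `Summit.Ventures.HSemireg.Wedge.WeilPurity`, which sees `….Wedge` and opens `….Wedge.Hankel`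
HIDING the th-6-glue names `Φ` / `isoQ` / `Φ_ι` of `WedgeHankelGlue.lean` — PART W's own `Φ` / `isoQ` / `Φ_ι` (the change of generators below) keep th-7's
printed names; `HSemiregBox.` ↦ `Summit.Ventures.HSemireg.WedgeBox.`, `HSemiregWeil` ↦ `….Wedge.Weil`), file 3 of 3.
MODEL / THEOREM (file 3, `weilPurity`, `weilPurity_vW`): in the wedge model of Weil type `(n,n)` (`N = n + n` pairs `x_c, y_c`; h-part `w_N(q)`) with the
two-exponential h-part `q_k = c₁λ^k + c₂μ^k` (`λ ≠ μ`) and `v = w_N(q) + a·Π_{c≥n}(x_c∧y_c) + b·Π_{c<n}(x_c∧y_c)` (resp. WeilRank's own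
`vW = w_N(q) + a·E_{Gm} + b·E_{Dm}`), `c₁c₂ab ≠ 0`, every field, every `n ≥ 1`: `rank(θ ↦ θ ∧ v ∣ ⋀ⁿ) + 4 + 2·[ab = c₁c₂(λ−μ)^{2n}] = 4·C(2n,n)`
(FORMULA-N PART B §L.5, STRUCTURE C16; `n = 2`: `18 ∣ 20`, T4a's (I2-β)).  Route: the change of generators `A0 = (x_c+λy_c)_{c≥n}`, `A1 = (x_c+μy_c)_{c<n}`,
`C0 = (x_c+λy_c)_{c<n}`, `C1 = (x_c+μy_c)_{c≥n}` is a linear equivalence; the induced isomorphism of exterior algebras carries PART V's `hbox c`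
(`c₀₀ = (−1)^{n·n}c₁`, `c₁₁ = c₂`, `c₀₁ = a/((−1)^{C(n,2)}(μ−λ)ⁿ)`, `c₁₀ = b/((−1)^{C(n,2)}(λ−μ)ⁿ)`) to `v` and `⋀ⁿ` to `⋀ⁿ`, and `det c = 0 ⟺ ab = c₁c₂(λ−μ)^{2n}`.
Sign-free (parities only).  This file: `Φ` on the four blocks, the transported coefficient matrix `tc` and its determinant, `Φ_hbox : Φ(hbox (tc …)) = vP`, **`weilPurity`** / `weilPurity_two`; supplement: WeilRank's basis-monomial Weil vectors are `(−1)^{C(n,2)}`·the pair products (`B_Dm_eq`, `B_Gm_eq`, via the sorted enumerations `eD`/`eG`), `vW_eq_vP`, **`weilPurity_vW`** / `weilPurity_vW_two`.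
-/

namespace Summit.Ventures.HSemireg.Wedge.WeilPurity

open Module Set Set.powersetCard Summit.Ventures.HSemireg.Wedge.Weil
open Summit.Ventures.HSemireg.Wedge.Hankel hiding Φ isoQ Φ_ι

variable (K : Type*) [Field K] (n : ℕ)

variable {n}

/-! #### `Φ` on the four blocks -/

/-- the induced isomorphism on an ordered product of generators. -/
lemma Φ_prod_ofFn (lam mu : K) (hlm : lam ≠ mu) (f : Fin n → (Summit.Ventures.HSemireg.WedgeBox.I n → K)) :
    Φ K n lam mu hlm (List.ofFn fun j => ExteriorAlgebra.ι K (f j)).prod =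
      (List.ofFn fun j => ExteriorAlgebra.ι K (ψ K n lam mu (f j))).prod := by
  rw [map_list_prod, List.map_ofFn]
  have hf : (⇑(Φ K n lam mu hlm) ∘ fun j => ExteriorAlgebra.ι K (f j)) =
      fun j => ExteriorAlgebra.ι K (ψ K n lam mu (f j)) := funext fun j => by
    simp only [Function.comp_apply, Φ_ι]
  rw [hf]

/-- `Φ (E_{A 0}) = Π_{c≥n}(x_c + λ·y_c)`. -/
lemma Φ_A0 (lam mu : K) (hlm : lam ≠ mu) :
    Φ K n lam mu hlm (Summit.Ventures.HSemireg.WedgeBox.B K n (Summit.Ventures.HSemireg.WedgeBox.Apc n 0 : powersetCard (Summit.Ventures.HSemireg.WedgeBox.I n) n)) =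
      gq K n lam n n := by
  rw [B_A0_eq, Φ_prod_ofFn, gq_eq_ofFn]
  have hf : (fun j : Fin n => ExteriorAlgebra.ι K (ψ K n lam mu (Summit.Ventures.HSemireg.WedgeBox.b K n (eoff n 0 (by omega) j)))) =
      fun j : Fin n => X K (n + n) (n + j) + lam • Y K (n + n) (n + j) := funext fun j => by
    rw [ψ_b, img_A0, ι_lin]
  rw [hf]

/-- `Φ (E_{A 1}) = Π_{c<n}(x_c + μ·y_c)`. -/
lemma Φ_A1 (lam mu : K) (hlm : lam ≠ mu) :
    Φ K n lam mu hlm (Summit.Ventures.HSemireg.WedgeBox.B K n (Summit.Ventures.HSemireg.WedgeBox.Apc n 1 : powersetCard (Summit.Ventures.HSemireg.WedgeBox.I n) n)) =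
      gq K n mu 0 n := by
  rw [B_A1_eq, Φ_prod_ofFn, gq_eq_ofFn]
  have hf : (fun j : Fin n => ExteriorAlgebra.ι K (ψ K n lam mu (Summit.Ventures.HSemireg.WedgeBox.b K n (eoff n n (by omega) j)))) =
      fun j : Fin n => X K (n + n) (0 + j) + mu • Y K (n + n) (0 + j) := funext fun j => by
    rw [ψ_b, img_A1, ι_lin, Nat.zero_add]
  rw [hf]

/-- `Φ (E_{C 0}) = Π_{c<n}(x_c + λ·y_c)`. -/
lemma Φ_C0 (lam mu : K) (hlm : lam ≠ mu) :
    Φ K n lam mu hlm (Summit.Ventures.HSemireg.WedgeBox.B K n (Summit.Ventures.HSemireg.WedgeBox.Cpc n 0 : powersetCard (Summit.Ventures.HSemireg.WedgeBox.I n) n)) =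
      gq K n lam 0 n := by
  rw [B_C0_eq, Φ_prod_ofFn, gq_eq_ofFn]
  have hf : (fun j : Fin n => ExteriorAlgebra.ι K (ψ K n lam mu (Summit.Ventures.HSemireg.WedgeBox.b K n (eoff n (n + n) (by omega) j)))) =
      fun j : Fin n => X K (n + n) (0 + j) + lam • Y K (n + n) (0 + j) := funext fun j => by
    rw [ψ_b, img_C0, ι_lin, Nat.zero_add]
  rw [hf]

/-- `Φ (E_{C 1}) = Π_{c≥n}(x_c + μ·y_c)`. -/
lemma Φ_C1 (lam mu : K) (hlm : lam ≠ mu) :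
    Φ K n lam mu hlm (Summit.Ventures.HSemireg.WedgeBox.B K n (Summit.Ventures.HSemireg.WedgeBox.Cpc n 1 : powersetCard (Summit.Ventures.HSemireg.WedgeBox.I n) n)) =
      gq K n mu n n := by
  rw [B_C1_eq, Φ_prod_ofFn, gq_eq_ofFn]
  have hf : (fun j : Fin n => ExteriorAlgebra.ι K (ψ K n lam mu (Summit.Ventures.HSemireg.WedgeBox.b K n (eoff n (n + n + n) (by omega) j)))) =
      fun j : Fin n => X K (n + n) (n + j) + mu • Y K (n + n) (n + j) := funext fun j => by
    rw [ψ_b, img_C1, ι_lin]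
  rw [hf]

/-! #### The Weil class in the pair-product normalisation and its box preimage -/

variable (n)

/-- `v = w_{2n}(q) + a·Π_{c≥n}(x_c∧y_c) + b·Π_{c<n}(x_c∧y_c)`, `q_k = c₁λ^k + c₂μ^k`. -/
noncomputable def vP (c₁ c₂ lam mu a b : K) : HT K (In (n + n)) :=
  w K (n + n) (n + n) (fun k => c₁ * lam ^ k + c₂ * mu ^ k) + a • pp K n n n + b • pp K n 0 n

/-- the sign `(−1)^{C(n,2)}`. -/
noncomputable def r : K := (-1 : K) ^ (n.choose 2)

/-- the transport matrix. -/
noncomputable def tc (c₁ c₂ lam mu a b : K) : Fin 2 → Fin 2 → K :=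
  fun α β =>
    if α = 0 then (if β = 0 then (-1 : K) ^ (n * n) * c₁ else a * (r K n * (mu - lam) ^ n)⁻¹)
    else (if β = 0 then b * (r K n * (lam - mu) ^ n)⁻¹ else c₂)

variable {n}

/-- entry `(0,0)` of the transport matrix: `(−1)^{n·n}·c₁`. -/
@[simp] lemma tc00 (c₁ c₂ lam mu a b : K) : tc K n c₁ c₂ lam mu a b 0 0 = (-1 : K) ^ (n * n) * c₁ := by
  simp [tc]
/-- entry `(0,1)` of the transport matrix: `a / ((−1)^{C(n,2)}(μ−λ)ⁿ)`. -/
@[simp] lemma tc01 (c₁ c₂ lam mu a b : K) : tc K n c₁ c₂ lam mu a b 0 1 = a * (r K n * (mu - lam) ^ n)⁻¹ := by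
  simp [tc]
/-- entry `(1,0)` of the transport matrix: `b / ((−1)^{C(n,2)}(λ−μ)ⁿ)`. -/
@[simp] lemma tc10 (c₁ c₂ lam mu a b : K) : tc K n c₁ c₂ lam mu a b 1 0 = b * (r K n * (lam - mu) ^ n)⁻¹ := by
  simp [tc]
/-- entry `(1,1)` of the transport matrix: `c₂`. -/
@[simp] lemma tc11 (c₁ c₂ lam mu a b : K) : tc K n c₁ c₂ lam mu a b 1 1 = c₂ := by
  simp [tc]

/-- the sign `(−1)^{C(n,2)}` is non-zero. -/
lemma r_ne_zero : r K n ≠ 0 := pow_ne_zero _ (neg_ne_zero.mpr one_ne_zero)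

/-- the sign `(−1)^{C(n,2)}` squares to one. -/
lemma r_mul_r : r K n * r K n = 1 := by
  rw [r, ← pow_add, ← two_mul, pow_mul, neg_one_sq, one_pow]

/-- `(−1)^{n·n}` squares to one. -/
lemma neg_one_pow_mul_self : (-1 : K) ^ (n * n) * (-1 : K) ^ (n * n) = 1 := by
  rw [← pow_add, ← two_mul, pow_mul, neg_one_sq, one_pow]

/-- all four entries of the transport matrix are non-zero (`c₁c₂ab ≠ 0`, `λ ≠ μ`). -/
lemma tc_ne_zero {c₁ c₂ lam mu a b : K} (h1 : c₁ ≠ 0) (h2 : c₂ ≠ 0) (hlm : lam ≠ mu) (ha : a ≠ 0)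
    (hb : b ≠ 0) : ∀ α β, tc K n c₁ c₂ lam mu a b α β ≠ 0 := by
  have hml : mu - lam ≠ 0 := sub_ne_zero.mpr (Ne.symm hlm)
  have hlm' : lam - mu ≠ 0 := sub_ne_zero.mpr hlm
  have hs : (-1 : K) ^ (n * n) ≠ 0 := pow_ne_zero _ (neg_ne_zero.mpr one_ne_zero)
  intro α β
  fin_cases α <;> fin_cases β
  · simpa using mul_ne_zero hs h1
  · simpa using mul_ne_zero ha (inv_ne_zero (mul_ne_zero (r_ne_zero K) (pow_ne_zero _ hml)))
  · simpa using mul_ne_zero hb (inv_ne_zero (mul_ne_zero (r_ne_zero K) (pow_ne_zero _ hlm')))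
  · simpa using h2

/-- **THE TRANSPORT**: the box with the transport matrix maps to the Weil class. -/
theorem Φ_hbox (c₁ c₂ lam mu a b : K) (hlm : lam ≠ mu) :
    Φ K n lam mu hlm (Summit.Ventures.HSemireg.WedgeBox.hbox K n (tc K n c₁ c₂ lam mu a b)) = vP K n c₁ c₂ lam mu a b := by
  have hml : mu - lam ≠ 0 := sub_ne_zero.mpr (Ne.symm hlm)
  have hlm' : lam - mu ≠ 0 := sub_ne_zero.mpr hlm
  rw [Summit.Ventures.HSemireg.WedgeBox.hbox, map_sum, Fin.sum_univ_two, map_sum, map_sum, Fin.sum_univ_two, Fin.sum_univ_two]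
  simp only [map_smul, map_mul, Φ_A0, Φ_A1, Φ_C0, Φ_C1, gq_A0_C0, gq_A1_C1, gq_A0_C1, gq_A1_C0, tc00, tc01, tc10,
    tc11, smul_smul]
  rw [vP, w_twoExp, ← r]
  have e1 : (-1 : K) ^ (n * n) * c₁ * (-1 : K) ^ (n * n) = c₁ := by
    rw [mul_comm, ← mul_assoc, neg_one_pow_mul_self, one_mul]
  have e2 : a * (r K n * (mu - lam) ^ n)⁻¹ * (r K n * (mu - lam) ^ n) = a := by
    rw [mul_assoc, inv_mul_cancel₀ (mul_ne_zero (r_ne_zero K) (pow_ne_zero _ hml)), mul_one]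
  have e3 : b * (r K n * (lam - mu) ^ n)⁻¹ * (r K n * (lam - mu) ^ n) = b := by
    rw [mul_assoc, inv_mul_cancel₀ (mul_ne_zero (r_ne_zero K) (pow_ne_zero _ hlm')), mul_one]
  rw [e1, e2, e3]
  abel

/-- the determinant of the transport matrix vanishes exactly on the purity locus. -/
lemma tc_det_iff (c₁ c₂ lam mu a b : K) (hlm : lam ≠ mu) :
    tc K n c₁ c₂ lam mu a b 0 0 * tc K n c₁ c₂ lam mu a b 1 1 =
      tc K n c₁ c₂ lam mu a b 0 1 * tc K n c₁ c₂ lam mu a b 1 0 ↔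
    a * b = c₁ * c₂ * (lam - mu) ^ (2 * n) := by
  have hml : mu - lam ≠ 0 := sub_ne_zero.mpr (Ne.symm hlm)
  have hlm' : lam - mu ≠ 0 := sub_ne_zero.mpr hlm
  have hD0 : (r K n * (mu - lam) ^ n) * (r K n * (lam - mu) ^ n) ≠ 0 :=
    mul_ne_zero (mul_ne_zero (r_ne_zero K) (pow_ne_zero _ hml)) (mul_ne_zero (r_ne_zero K) (pow_ne_zero _ hlm'))
  have hD : (r K n * (mu - lam) ^ n) * (r K n * (lam - mu) ^ n) = (-1 : K) ^ n * (lam - mu) ^ (2 * n) := by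
    rw [show mu - lam = -(lam - mu) by ring, neg_pow, show r K n * ((-1) ^ n * (lam - mu) ^ n) * (r K n * (lam - mu) ^ n)
      = (r K n * r K n) * ((-1) ^ n * ((lam - mu) ^ n * (lam - mu) ^ n)) by ring, r_mul_r, one_mul, ← pow_add, ← two_mul]
  have hsq : (-1 : K) ^ (n * n) * (-1 : K) ^ n = 1 := by
    rw [← pow_add, ← Nat.mul_succ]
    exact (Nat.even_mul_succ_self n).neg_one_pow
  rw [tc00, tc01, tc10, tc11, show a * (r K n * (mu - lam) ^ n)⁻¹ * (b * (r K n * (lam - mu) ^ n)⁻¹) =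
    a * b * ((r K n * (mu - lam) ^ n) * (r K n * (lam - mu) ^ n))⁻¹ by rw [mul_inv]; ring,
    eq_mul_inv_iff_mul_eq₀ hD0, hD, show (-1 : K) ^ (n * n) * c₁ * c₂ * ((-1) ^ n * (lam - mu) ^ (2 * n)) =
    ((-1 : K) ^ (n * n) * (-1) ^ n) * (c₁ * c₂ * (lam - mu) ^ (2 * n)) by ring, hsq, one_mul]
  exact ⟨fun h => h.symm, fun h => h.symm⟩

open Classical in
/-- **THE WEIL-FRAME PURITY LOCUS (FORMULA-N PART B §L.5; STRUCTURE C16; the degree `m = n` that THEOREM R-B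
excludes), wedge model, every field, every `n ≥ 1`**: for `v = w_{2n}(q) + a·Π_{c≥n}(x_c∧y_c) + b·Π_{c<n}(x_c∧y_c)`
with two-exponential h-part `q_k = c₁λ^k + c₂μ^k` (`λ ≠ μ`) and `c₁c₂ab ≠ 0`, the rank of `θ ↦ θ ∧ v` on `⋀ⁿ(K^{2N})`,
`N = 2n`, satisfies `rank + 4 + 2·[ab = c₁c₂(λ−μ)^{2n}] = 4·C(2n,n)`: generic value `4·C(2n,n) − 4`, dropping by
exactly two on the purity locus `ab = c₁c₂(λ−μ)^{2n}`. -/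
theorem weilPurity (hn : 0 < n) {c₁ c₂ lam mu a b : K} (h1 : c₁ ≠ 0) (h2 : c₂ ≠ 0) (hlm : lam ≠ mu)
    (ha : a ≠ 0) (hb : b ≠ 0) :
    Module.finrank K (LinearMap.range (wedge K (n + n) n (vP K n c₁ c₂ lam mu a b))) + 4 +
      2 * (if a * b = c₁ * c₂ * (lam - mu) ^ (2 * n) then 1 else 0) = 4 * (n + n).choose n := by
  rw [← Φ_hbox K c₁ c₂ lam mu a b hlm, finrank_range_wedge_Φ]
  have h := Summit.Ventures.HSemireg.WedgeBox.finrank_range_wedgeMap_hbox_degree_n K (tc K n c₁ c₂ lam mu a b) hn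
    (tc_ne_zero K h1 h2 hlm ha hb)
  by_cases hdet : a * b = c₁ * c₂ * (lam - mu) ^ (2 * n)
  · rw [if_pos hdet]; rwa [if_pos ((tc_det_iff K c₁ c₂ lam mu a b hlm).mpr hdet)] at h
  · rw [if_neg hdet]; rwa [if_neg (fun h' => hdet ((tc_det_iff K c₁ c₂ lam mu a b hlm).mp h'))] at h

open Classical in
/-- the `n = 2` numbers (STEP-0 / T4a `(I2-β)`): rank `18` on the purity locus `ab = c₁c₂(λ−μ)⁴`, `20` off it. -/
theorem weilPurity_two {c₁ c₂ lam mu a b : K} (h1 : c₁ ≠ 0) (h2 : c₂ ≠ 0) (hlm : lam ≠ mu)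
    (ha : a ≠ 0) (hb : b ≠ 0) :
    Module.finrank K (LinearMap.range (wedge K (2 + 2) 2 (vP K 2 c₁ c₂ lam mu a b))) =
      if a * b = c₁ * c₂ * (lam - mu) ^ 4 then 18 else 20 := by
  have h := weilPurity K (n := 2) (by norm_num) h1 h2 hlm ha hb
  have e : (2 + 2).choose 2 = 6 := by decide
  rw [e, show 2 * 2 = 4 from rfl] at h
  split_ifs at h ⊢ with hdet <;> omega

end Summit.Ventures.HSemireg.Wedge.WeilPurity

/-! ### PART W, supplement: WeilRank's basis-monomial Weil vectors `E_{Dm}`, `E_{Gm}` are `(−1)^{C(n,2)}` times the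
pair products, hence the purity theorem for WeilRank's own class `vW` (literal restatement). -/

namespace Summit.Ventures.HSemireg.Wedge.WeilPurity

open Module Set Set.powersetCard Summit.Ventures.HSemireg.Wedge.Weil
open Summit.Ventures.HSemireg.Wedge.Hankel hiding Φ isoQ Φ_ι

variable (K : Type*) [Field K] (n : ℕ)

/-- `Π_{c=s}^{s+m-1} x_c` (ordered). -/
noncomputable def Xp (s : ℕ) : ℕ → HT K (In (n + n))
  | 0 => 1
  | m + 1 => Xp s m * X K (n + n) (s + m)

/-- `Π_{c=s}^{s+m-1} y_c` (ordered). -/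
noncomputable def Yp (s : ℕ) : ℕ → HT K (In (n + n))
  | 0 => 1
  | m + 1 => Yp s m * Y K (n + n) (s + m)

variable {n}

/-- `x_c ∧ y_{c'} = −(y_{c'} ∧ x_c)`. -/
lemma X_mul_Y_anticomm (c c' : ℕ) :
    X K (n + n) c * Y K (n + n) c' = -(Y K (n + n) c' * X K (n + n) c) := by
  rw [← ι_xv, ← ι_yv]
  exact eq_neg_of_add_eq_zero_left (ExteriorAlgebra.ι_add_mul_swap _ _)

/-- an `x`-letter passes the ordered product `y_s ⋯ y_{s+m−1}` with the sign `(−1)^m`. -/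
lemma X_mul_Yp (c s : ℕ) : ∀ m : ℕ,
    X K (n + n) c * Yp K n s m = ((-1 : K) ^ m) • (Yp K n s m * X K (n + n) c)
  | 0 => by rw [Yp, mul_one, one_mul, pow_zero, one_smul]
  | m + 1 => by
    rw [Yp, ← mul_assoc, X_mul_Yp c s m, smul_mul_assoc, mul_assoc, X_mul_Y_anticomm, mul_neg, mul_assoc,
      smul_neg, pow_succ, mul_neg_one, neg_smul]

/-- un-interleaving: `(Π x_c)(Π y_c) = (−1)^{C(m,2)} Π (x_c ∧ y_c)`. -/
lemma Xp_mul_Yp (s : ℕ) : ∀ m : ℕ, Xp K n s m * Yp K n s m = ((-1 : K) ^ (m.choose 2)) • pp K n s m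
  | 0 => by rw [Xp, Yp, pp, mul_one, Nat.choose_zero_succ, pow_zero, one_smul]
  | m + 1 => by
    rw [Xp, Yp, pp]
    have h1 : Xp K n s m * X K (n + n) (s + m) * (Yp K n s m * Y K (n + n) (s + m)) =
        ((-1 : K) ^ m) • ((Xp K n s m * Yp K n s m) * (X K (n + n) (s + m) * Y K (n + n) (s + m))) := by
      rw [mul_assoc, ← mul_assoc (X K (n + n) (s + m)), X_mul_Yp, smul_mul_assoc, mul_smul_comm,
        mul_assoc (Yp K n s m), ← mul_assoc (Xp K n s m)]
    rw [h1, Xp_mul_Yp s m, smul_mul_assoc, smul_smul, ← pow_add]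
    congr 2
    rw [Nat.choose_succ_succ', Nat.choose_one_right, Nat.add_comm]

/-- the ordered product `x_s ⋯ x_{s+m−1}` as a `List.ofFn` product. -/
lemma Xp_eq_ofFn (s : ℕ) : ∀ m : ℕ, Xp K n s m = (List.ofFn fun j : Fin m => X K (n + n) (s + j)).prod
  | 0 => by rw [Xp, List.ofFn_zero, List.prod_nil]
  | m + 1 => by
    rw [Xp, Xp_eq_ofFn s m, List.ofFn_succ', List.concat_eq_append, List.prod_append, List.prod_singleton,
      Fin.val_last]
    rfl

/-- the ordered product `y_s ⋯ y_{s+m−1}` as a `List.ofFn` product. -/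
lemma Yp_eq_ofFn (s : ℕ) : ∀ m : ℕ, Yp K n s m = (List.ofFn fun j : Fin m => Y K (n + n) (s + j)).prod
  | 0 => by rw [Yp, List.ofFn_zero, List.prod_nil]
  | m + 1 => by
    rw [Yp, Yp_eq_ofFn s m, List.ofFn_succ', List.concat_eq_append, List.prod_append, List.prod_singleton,
      Fin.val_last]
    rfl

/-! #### the sorted enumerations of `Dm N n` and `Gm N n` (`N = n + n`) -/

/-- enumeration of the pairs from `s`: first the `x`'s, then the `y`'s. -/
noncomputable def enum (s : ℕ) (hs : s + n ≤ n + n) (j : Fin (n + n)) : In (n + n) :=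
  if h : (j : ℕ) < n then xI (s + j) (by omega) else yI (s + (j - n)) (by have := j.2; omega)

/-- the enumeration (first the `x`'s, then the `y`'s) of `n` consecutive pairs is strictly increasing. -/
lemma enum_strictMono (s : ℕ) (hs : s + n ≤ n + n) : StrictMono (enum (n := n) s hs) := by
  intro i j hij
  have hij' : (i : ℕ) < j := hij
  have hj := j.2
  simp only [enum]
  split_ifs with h1 h2 h2
  · show (⟨s + i, _⟩ : Fin _) < ⟨s + j, _⟩
    rw [Fin.mk_lt_mk]; omega
  · show (⟨s + i, _⟩ : Fin _) < ⟨n + n + (s + (j - n)), _⟩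
    rw [Fin.mk_lt_mk]; omega
  · omega
  · show (⟨n + n + (s + (i - n)), _⟩ : Fin _) < ⟨n + n + (s + (j - n)), _⟩
    rw [Fin.mk_lt_mk]; omega

/-- the lower block of type `(n,n)` has `n + n` indices. -/
lemma card_Dm_nn : (Dm (n + n) n).card = n + n := card_Dm (N := n + n) (by omega)

/-- the upper block of type `(n,n)` has `n + n` indices. -/
lemma card_Gm_nn : (Gm (n + n) n).card = n + n := by
  rw [card_Gm (N := n + n) (by omega)]; omega

/-- the enumeration from pair `0` lands in the lower block `Dm (n+n) n`. -/
lemma enum_mem_Dm (j : Fin (n + n)) : enum (n := n) 0 (by omega) j ∈ Dm (n + n) n := by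
  have hj := j.2
  simp only [enum, Nat.zero_add]
  split_ifs with h
  · rw [xI_eq_xJ, xJ_mem_Dm_iff]; exact h
  · rw [yI_eq_yJ, yJ_mem_Dm_iff]; show (j : ℕ) - n < n; omega

/-- the enumeration from pair `n` lands in the upper block `Gm (n+n) n`. -/
lemma enum_mem_Gm (j : Fin (n + n)) : enum (n := n) n (le_refl _) j ∈ Gm (n + n) n := by
  have hj := j.2
  simp only [enum]
  split_ifs with h
  · rw [xI_mem_Gm_iff]; omega
  · rw [yI_mem_Gm_iff]; omega

/-- the generator at an enumerated index is the corresponding `x`- or `y`-letter. -/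
lemma ι_b_enum (s : ℕ) (hs : s + n ≤ n + n) (j : Fin (n + n)) :
    ExteriorAlgebra.ι K (b K (In (n + n)) (enum (n := n) s hs j)) =
      if (j : ℕ) < n then X K (n + n) (s + j) else Y K (n + n) (s + (j - n)) := by
  have hj := j.2
  unfold enum
  split_ifs with h
  · rw [X, dif_pos (by omega), gx_eq_ι]
  · rw [Y, dif_pos (by omega), gx_eq_ι]

/-- a monomial whose support is enumerated (in increasing order) by `enum s` is `Xp s n * Yp s n`. -/
lemma B_eq_Xp_mul_Yp {D : Finset (In (n + n))} (hD : D.card = n + n) (s : ℕ) (hs : s + n ≤ n + n)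
    (hmem : ∀ j, enum (n := n) s hs j ∈ D) : B K (In (n + n)) D = Xp K n s n * Yp K n s n := by
  have he : ⇑(ofFinEmbEquiv.symm (ofCard hD)) = enum (n := n) s hs := by
    rw [ofFinEmbEquiv_symm_apply]
    exact (Finset.orderEmbOfFin_unique _ hmem (enum_strictMono s hs)).symm
  rw [B_apply, ExteriorAlgebra.basis_apply_ofCard (b K (In (n + n))) hD, ExteriorAlgebra.ιMulti_family,
    ExteriorAlgebra.ιMulti_apply]
  have hf : (fun i : Fin (n + n) => ExteriorAlgebra.ι K (((b K (In (n + n))) ∘ ⇑(ofFinEmbEquiv.symm (ofCard hD))) i)) =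
      fun i : Fin (n + n) => ExteriorAlgebra.ι K (b K (In (n + n)) (enum (n := n) s hs i)) := by
    rw [he]; rfl
  rw [hf, List.ofFn_add, List.prod_append, Xp_eq_ofFn, Yp_eq_ofFn]
  congr 1
  · exact congrArg List.prod (congrArg List.ofFn (funext fun i => by
      have hi := i.2
      rw [ι_b_enum, Fin.val_castLE, if_pos hi]))
  · exact congrArg List.prod (congrArg List.ofFn (funext fun i => by
      rw [ι_b_enum, Fin.val_natAdd, if_neg (by omega), Nat.add_sub_cancel_left]))

/-- WeilRank's lower Weil monomial `E_{Dm}` is `(−1)^{C(n,2)}` times the pair product `Π_{c<n}(x_c ∧ y_c)`. -/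
lemma B_Dm_eq : B K (In (n + n)) (Dm (n + n) n) = r K n • pp K n 0 n := by
  rw [B_eq_Xp_mul_Yp K card_Dm_nn 0 (by omega) enum_mem_Dm, Xp_mul_Yp, r]

/-- WeilRank's upper Weil monomial `E_{Gm}` is `(−1)^{C(n,2)}` times the pair product `Π_{c≥n}(x_c ∧ y_c)`. -/
lemma B_Gm_eq : B K (In (n + n)) (Gm (n + n) n) = r K n • pp K n n n := by
  rw [B_eq_Xp_mul_Yp K card_Gm_nn n (le_refl _) enum_mem_Gm, Xp_mul_Yp, r]

/-- WeilRank's `vW` with a two-exponential h-part is `vP` with `(a, b) ↦ (r·a, r·b)`, `r = (−1)^{C(n,2)}`. -/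
lemma vW_eq_vP (c₁ c₂ lam mu a b : K) :
    vW K (n + n) n (fun k => c₁ * lam ^ k + c₂ * mu ^ k) a b = vP K n c₁ c₂ lam mu (a * r K n) (b * r K n) := by
  rw [vW, vP, B_Dm_eq, B_Gm_eq, smul_smul, smul_smul]

open Classical in
/-- **THE WEIL-FRAME PURITY LOCUS for WeilRank's own class** `vW q a b = w_{2n}(q) + a·E_{Gm} + b·E_{Dm}`
(`q_k = c₁λ^k + c₂μ^k`, `λ ≠ μ`, `c₁c₂ab ≠ 0`; every field, every `n ≥ 1`):
`rank(θ ↦ θ ∧ vW on ⋀ⁿ) + 4 + 2·[ab = c₁c₂(λ−μ)^{2n}] = 4·C(2n,n)` — the degree `m = n` complement of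
`Summit.Ventures.HSemireg.Wedge.Weil.weilRank_nn_deg` (FORMULA-N PART B §L.5, STRUCTURE C16). -/
theorem weilPurity_vW (hn : 0 < n) {c₁ c₂ lam mu a b : K} (h1 : c₁ ≠ 0) (h2 : c₂ ≠ 0) (hlm : lam ≠ mu)
    (ha : a ≠ 0) (hb : b ≠ 0) :
    Module.finrank K (LinearMap.range (wedge K (n + n) n (vW K (n + n) n (fun k => c₁ * lam ^ k + c₂ * mu ^ k) a b)))
      + 4 + 2 * (if a * b = c₁ * c₂ * (lam - mu) ^ (2 * n) then 1 else 0) = 4 * (n + n).choose n := by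
  rw [vW_eq_vP]
  have h := weilPurity K (n := n) hn (c₁ := c₁) (c₂ := c₂) (lam := lam) (mu := mu) (a := a * r K n)
    (b := b * r K n) h1 h2 hlm (mul_ne_zero ha (r_ne_zero K (n := n))) (mul_ne_zero hb (r_ne_zero K (n := n)))
  have e : a * r K n * (b * r K n) = a * b := by
    rw [show a * r K n * (b * r K n) = a * b * (r K n * r K n) by ring, r_mul_r, mul_one]
  rw [e] at h
  exact h

open Classical in
/-- `n = 2`: `rank = 18` on `ab = c₁c₂(λ−μ)⁴`, `20` off it, for WeilRank's `vW` (T4a's 18 ∣ 20). -/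
theorem weilPurity_vW_two {c₁ c₂ lam mu a b : K} (h1 : c₁ ≠ 0) (h2 : c₂ ≠ 0) (hlm : lam ≠ mu)
    (ha : a ≠ 0) (hb : b ≠ 0) :
    Module.finrank K (LinearMap.range (wedge K (2 + 2) 2 (vW K (2 + 2) 2 (fun k => c₁ * lam ^ k + c₂ * mu ^ k) a b)))
      = if a * b = c₁ * c₂ * (lam - mu) ^ 4 then 18 else 20 := by
  have h := weilPurity_vW K (n := 2) (by norm_num) h1 h2 hlm ha hb
  have e : (2 + 2).choose 2 = 6 := by decide
  rw [e, show 2 * 2 = 4 from rfl] at h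
  split_ifs at h ⊢ with hdet <;> omega

end Summit.Ventures.HSemireg.Wedge.WeilPurity
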